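import Summits.BirchSwinnertonDyer.Rank1Residual.GaloisImage.KolyvaginDeepLedger
import Literature.NumberTheory.EllipticCurves.KuriharaNumber
import HarnessLib

/-!
# The DEEP half of the (a′) assembly: at one deep level, the transported certificate and the
# visible `L`-value give `p^{v+1−j} ∣ #Sel_{p^{k+1}}(E/ℚ)` (team n1011, ROUTE-1 §20.4 (C20),
# sub-target R1-23, skeleton `cells/n1011/skel/T-R1-23.md` steps S4–S6; p18)

HONEST FRAMING (cell `b2b-bsdres`, run/shared/lean/b2b/bsd-rank1-residual/, verbatim in every
file): the goal of the cell is to DELETE the COMBINATION-SHAPED residual classes of the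
Birch–Swinnerton-Dyer formula for ALL analytic-rank `≤ 1` elliptic curves over `ℚ` — "full BSD
formula for every rank `≤ 1` curve in class `C`" assembled STRICTLY from published theorems — so
that the rank-`≤ 1` remainder becomes exactly the CONSTRUCTION-SHAPED classes, which are TYPED
(missing-input `Prop`s), NOT attempted. This is not "finishing BSD". Team n1011 (N10/N11, the
additive block `X4 ∧ p = 3`): research route; TOOL theorems, no class theorem, nothing booked, no
mark changed, no fact.

## What and why

At a DEEP level `K = k + 1 > X + t + v` (`p^X` kills `Sel_{p^K}(E/ℚ)`, `v = ord_p(L(E,1)/Ω)`,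
`p^t = #E(ℚ_p)[p]`) the `L`-value is visible in the Kato–Kurihara dictionary: the empty-level clause
reads `Λ(loc κ_∅) = u · p^t · δ̃_1` with `δ̃_1 = [0]⁺ ≡ p^v · unit`.  With Kato's Kolyvagin system
written on the generator, `κ′ = a′ · g`, and the TRANSPORTED certificate `p^{t+j} ∤ a′` (shallow
half `KuriharaCertificateShallow` + p11's scalar transport), the visibility lemma
(`Ledger.exists_eq_pow_mul_unit_of_natCast_mul_eq`) gives `Λ(loc g_∅) = p^β · unit` with
`β = t + v − ord_p a′ ≥ v − j + 1`, and the deep ledger (`DeepLedger.pow_dvd_natCard_selmerGroup_kummer`)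
gives `p^β ∣ #H¹_𝓚(ℚ, E[p^K]) = #Sel_{p^K}(E/ℚ)`.  Main: `pow_dvd_natCard_selmerGroup_of_deep`, in
WITNESS currency (explicit `κ, κ′, Λ, g, a′, N`; the hypotheses are the dictionary clauses at the
deep level, Sakamoto's Thm. 4.4 (2) at the empty level in ORDER form (R1-22), the Poitou–Tate count
(`KolyvaginPropagatedCount`), and the Selmer-group exponent).

References: C.-H. Kim, AJM 148 (2026) Thm. 1.9 (6), Thm. 3.13 [Kim2022StructureSelmer]; R. Sakamoto,
JTNB 36 (2024) Thm. 4.4 [Sakamoto2024]; K. Kato, Astérisque 295 (2004) Thm. 12.5 (1)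
[Kato2004Asterisque]; B. Mazur, K. Rubin, Mem. AMS 799 (2004) App. A (33) [MazurRubin2004].
-/

noncomputable section

open scoped Classical NumberField
open NumberField IsDedekindDomain WeierstrassCurve
  Literature.NumberTheory.EllipticCurves
  Literature.NumberTheory.GaloisRepresentations
  Literature.NumberTheory.GaloisRepresentations.DiscreteGaloisModule Literature.NumberTheory.GaloisCohomology

namespace Summit.BirchSwinnertonDyer.Rank1Residual.GaloisImage.DeepLedger

open CongruenceSubgroup

variable (W : WeierstrassCurve ℚ) [W.IsElliptic] (p : ℕ) [hp : Fact p.Prime] (k : ℕ)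

omit hp in
/-- `p^m · (unit) ≠ 0` in `ℤ/p^K` for `m < K`. [folklore] -/
theorem pow_mul_unit_ne_zero {K m : ℕ} [Fact p.Prime] (hm : m < K) (w : (ZMod (p ^ K))ˣ) :
    ((p ^ m : ℕ) : ZMod (p ^ K)) * (w : ZMod (p ^ K)) ≠ 0 := by
  intro h
  rw [Units.mul_left_eq_zero] at h
  rw [ZMod.natCast_eq_zero_iff] at h
  have := Nat.pow_dvd_pow_iff_le_right (Fact.out : p.Prime).one_lt |>.1 h
  omega

/-- **The deep half of (a′) (skeleton steps S4–S6).**  Let `K = k + 1`.  Data at the deep level: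
the dictionary's `Λ` with its kernel clause (`hker`), Kato's families `κ, κ′` with the empty-level
bridge `κ′_∅ = κ_∅` and the empty-level dictionary value `Λ(loc κ_∅) = u · p^t · δ̃_1` where
`δ̃_1 ≡ p^v · (unit)` (`v = ord_p [0]⁺`, `t + v < K`); the generator's bottom class `g_∅ ∈ H¹_{𝓕_can}`
with `κ′_∅ = a′ · g_∅`, Sakamoto's Thm. 4.4 (2) at the empty level in ORDER form for `N = p^l`
(`hR22`) and the Poitou–Tate count `#H¹_{𝓕_can} = p^K · N` (`hcount`); the TRANSPORTED certificate
`p^{t+j} ∤ a′`; and the Selmer group `H¹_𝓚 = Sel_{p^K}` killed by `p^X` with `X + t + v ≤ K`.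
Then **`p^{v+1−j} ∣ #Sel_{p^K}(E/ℚ)`**.
[cite: Kim2022StructureSelmer, Thm. 1.9 (6) and Thm. 3.13] [cite: Sakamoto2024, Thm. 4.4 (2) (p. 926)] -/
theorem pow_dvd_natCard_selmerGroup_of_deep (hp2 : p ≠ 2) {v₀ : HeightOneSpectrum (𝓞 ℚ)}
    (hv₀ : ((p : ℕ) : 𝓞 ℚ) ∈ v₀.asIdeal)
    (Λ : galoisCohomology ((W.torsionGaloisModule ((p : ℤ) ^ k * (p : ℤ))).toLocal (Sum.inr v₀)) 1
      →+ ZMod (p ^ (k + 1)))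
    (hker : ∀ x ∈ propagatedSelmerStructure W p k (Sum.inr v₀),
      Λ x = 0 ↔ x ∈ W.kummerSelmerStructure ((p : ℤ) ^ k * (p : ℤ)) (Sum.inr v₀))
    -- Kato's classes at the empty level and the dictionary value there
    {κ₀ κ₀' g₀ : galoisCohomology (W.torsionGaloisModule ((p : ℤ) ^ k * (p : ℤ))) 1}
    (hbr₀ : κ₀' = κ₀) {t v : ℕ} (htv : t + v < k + 1) (u w₀ : (ZMod (p ^ (k + 1)))ˣ)
    {δ₁ : ZMod (p ^ (k + 1))} (hδ₁ : δ₁ = ((p ^ v : ℕ) : ZMod (p ^ (k + 1))) * (w₀ : ZMod _))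
    (hdict₀ : Λ (galoisCohomology.localization _ (Sum.inr v₀) 1 κ₀) =
      (u : ZMod (p ^ (k + 1))) * (p : ZMod (p ^ (k + 1))) ^ t * δ₁)
    -- the generator's bottom class, Kato's scalar, Thm. 4.4 (2) at `∅`, the count
    (hg₀ : g₀ ∈ (propagatedSelmerStructure W p k).selmerGroup) {a' : ℕ} (ha' : κ₀' = a' • g₀)
    {N : ℕ} (hNp : ∃ l, N = p ^ l)
    (hR22 : (N ∣ p ^ (k + 1) → addOrderOf g₀ * N = p ^ (k + 1)) ∧ (p ^ (k + 1) ∣ N → g₀ = 0))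
    (hcount : Nat.card (propagatedSelmerStructure W p k).selmerGroup = p ^ (k + 1) * N)
    -- the transported certificate
    {j : ℕ} (hcert : ¬ p ^ (t + j) ∣ a')
    -- the Selmer group's exponent and the depth
    {X : ℕ} (hX : ∀ s ∈ (W.kummerSelmerStructure ((p : ℤ) ^ k * (p : ℤ))).selmerGroup, p ^ X • s = 0)
    (hK : X + t + v ≤ k + 1) :
    p ^ (v + 1 - j) ∣ Nat.card (W.kummerSelmerStructure ((p : ℤ) ^ k * (p : ℤ))).selmerGroup := by
  haveI : NeZero (p ^ (k + 1)) := ⟨pow_ne_zero _ hp.out.ne_zero⟩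
  -- trivial when `j > v`
  rcases Nat.lt_or_ge v j with hvj | hjv
  · rw [show v + 1 - j = 0 by omega, pow_zero]; exact one_dvd _
  -- `a′ · Λ(loc g₀) = p^{t+v} · (u w₀)`
  have hval : (a' : ZMod (p ^ (k + 1))) * Λ (galoisCohomology.localization _ (Sum.inr v₀) 1 g₀) =
      ((p ^ (t + v) : ℕ) : ZMod (p ^ (k + 1))) * ((u * w₀ : (ZMod (p ^ (k + 1)))ˣ) : ZMod _) := by
    rw [← nsmul_eq_mul, ← map_nsmul, ← map_nsmul, ← ha', hbr₀, hdict₀, hδ₁, Units.val_mul]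
    push_cast
    ring
  -- `a′ ≠ 0`, `a′ = p^α b`, `p ∤ b`, `α ≤ t + j − 1 ≤ t + v`
  have ha0 : a' ≠ 0 := by
    rintro rfl
    rw [Nat.cast_zero, zero_mul] at hval
    exact pow_mul_unit_ne_zero p htv _ hval.symm
  obtain ⟨α, b, hb, hab⟩ := Nat.exists_eq_pow_mul_and_not_dvd ha0 p hp.out.ne_one
  have hα : α < t + j := by
    by_contra hle
    exact hcert (hab ▸ (Nat.pow_dvd_pow p (not_lt.mp hle)).mul_right b)
  rw [hab] at hval
  obtain ⟨w', hw'⟩ := Ledger.exists_eq_pow_mul_unit_of_natCast_mul_eq (p := p) htv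
    (show α ≤ t + v by omega) hb _ (u * w₀) hval
  -- the deep ledger with `β = t + v − α`
  have hβ := pow_dvd_natCard_selmerGroup_kummer W p k hp2 hv₀ Λ hker hNp hcount hg₀ hR22
    (β := t + v - α) (by omega) w' hw' hX (by omega)
  exact (Nat.pow_dvd_pow p (by omega)).trans hβ

end Summit.BirchSwinnertonDyer.Rank1Residual.GaloisImage.DeepLedger

end
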